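import Mathlib
import HarnessLib
import Summits.HubbardSuperconductivity.HubbardSuperconductivity.Theorems.KLProgrammeFermiSurfaceFST2Regularity

/-!
# Route `KLProgramme` (cruxes K3/K1): FST II's geometric constants `(|e|₂, r₀, g₀, w_min)` for the Hubbard
# band, in closed form and on the certified window

Cell `gate-hubbard-kl`, risk-register item r2; continues `KLProgrammeFermiSurfaceFST2Regularity.lean`. The typer
file `FermiRG/FST2Hypotheses.lean` records as `FermiRG.GeomConstants e K r₀ g₀ wmin` the numbers on which «the
constant `Q_V` depends only» (FST II Thm 1.1) and likewise all constants of [II], [III]: `|e|₂ ≤ K`,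
`|∇e| ≥ g₀` and `(t, e'' t) ≥ wmin |t|²` for tangent `t` on the neighbourhood `{|e| < r₀}` of `S`. For
`e = fun p ↦ squareDispersion 1 0 p - μ` we PROVE (`klfs_geomConstants`), for every level `-8/3 < μ < 0`:

  `K = 4 + |μ|`, `r₀ = -μ/2`, `g₀ = √((-μ/2)(4 + 3μ/2))`, `wmin = -μ/4`,

from `‖D⁰e‖ ≤ 4 + |μ|`, `‖De‖ ≤ 4`, `‖D²e‖ ≤ 4` (`klfs_norm_iteratedFDeriv_e_le`), the velocity envelope
`‖∇ε‖² ≥ -μ'(4 + μ')` at the nearby levels `μ' ∈ (3μ/2, μ/2)`, and the tangent Hessian bound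
`(t, e'' t) ≥ (-μ'/2)|t|²` (`klfs_hessQuad_tangent_ge`); and the uniform instance on the certified window
`μ ∈ [-0.4267, -0.1798]`: `GeomConstants e 4.4267 0.0899 0.579 0.0449` (`klfs_window_geomConstants`).
No definitions; everything PROVED. [folklore]
-/

noncomputable section

open Real Set

-- the tree's namespace `Summit.<Summit>.<Problem>.Theorems` repeats the summit name by design (D-0017)
set_option linter.dupNamespace false

namespace Summit.HubbardSuperconductivity.HubbardSuperconductivity.Theorems

open Literature.MathematicalPhysics.QuantumLattice

/-! ### §1 `|e|₂`: the derivatives of order `≤ 2` -/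

/-- The coordinate projections have operator norm `≤ 1`. [folklore] -/
theorem klfs_norm_proj_le (i : Fin 2) : ‖(PiLp.proj 2 (fun _ : Fin 2 => ℝ) i : Momentum →L[ℝ] ℝ)‖ ≤ 1 :=
  ContinuousLinearMap.opNorm_le_bound _ zero_le_one fun q => by
    rw [one_mul]; exact PiLp.norm_apply_le q i

/-- `‖(c) • Pᵢ‖ ≤ |c|` and `‖((c) • Pᵢ).smulRight Pᵢ‖ ≤ |c|` for the coordinate projections. [folklore] -/
theorem klfs_norm_smul_proj_le (c : ℝ) (i : Fin 2) :
    ‖c • (PiLp.proj 2 (fun _ : Fin 2 => ℝ) i : Momentum →L[ℝ] ℝ)‖ ≤ |c| ∧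
      ‖(c • (PiLp.proj 2 (fun _ : Fin 2 => ℝ) i : Momentum →L[ℝ] ℝ)).smulRight
          (PiLp.proj 2 (fun _ : Fin 2 => ℝ) i : Momentum →L[ℝ] ℝ)‖ ≤ |c| := by
  have h := klfs_norm_proj_le i
  have hn : 0 ≤ ‖(PiLp.proj 2 (fun _ : Fin 2 => ℝ) i : Momentum →L[ℝ] ℝ)‖ := norm_nonneg _
  have hc := abs_nonneg c
  have h1 : ‖c • (PiLp.proj 2 (fun _ : Fin 2 => ℝ) i : Momentum →L[ℝ] ℝ)‖ ≤ |c| := by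
    rw [norm_smul, Real.norm_eq_abs]; nlinarith
  refine ⟨h1, ?_⟩
  rw [ContinuousLinearMap.norm_smulRight_apply]
  nlinarith [norm_nonneg (c • (PiLp.proj 2 (fun _ : Fin 2 => ℝ) i : Momentum →L[ℝ] ℝ))]

/-- `‖De(z)‖ ≤ 4`. [folklore] -/
theorem klfs_norm_fderiv_e_le (μ : ℝ) (z : Momentum) :
    ‖fderiv ℝ (fun q : Momentum => squareDispersion 1 0 q - μ) z‖ ≤ 4 := by
  rw [klfs_fderiv_e]
  have h0 := (klfs_norm_smul_proj_le (2 * Real.sin (z 0)) 0).1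
  have h1 := (klfs_norm_smul_proj_le (2 * Real.sin (z 1)) 1).1
  have hs0 := Real.abs_sin_le_one (z 0); have hs1 := Real.abs_sin_le_one (z 1)
  rw [abs_mul, abs_two] at h0 h1
  exact (norm_add_le_of_le h0 h1).trans (by linarith)

/-- `‖D²e(z)‖ ≤ 4`. [folklore] -/
theorem klfs_norm_fderiv_fderiv_e_le (μ : ℝ) (z : Momentum) :
    ‖fderiv ℝ (fderiv ℝ (fun q : Momentum => squareDispersion 1 0 q - μ)) z‖ ≤ 4 := by
  rw [(klfs_hasFDerivAt_fderiv_e μ z).fderiv]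
  have h0 := (klfs_norm_smul_proj_le (2 * Real.cos (z 0)) 0).2
  have h1 := (klfs_norm_smul_proj_le (2 * Real.cos (z 1)) 1).2
  have hc0 := Real.abs_cos_le_one (z 0); have hc1 := Real.abs_cos_le_one (z 1)
  rw [abs_mul, abs_two] at h0 h1
  set A : Momentum →L[ℝ] Momentum →L[ℝ] ℝ :=
    ((2 * Real.cos (z 0)) • (PiLp.proj 2 (fun _ : Fin 2 => ℝ) 0 : Momentum →L[ℝ] ℝ)).smulRight
      (PiLp.proj 2 (fun _ : Fin 2 => ℝ) 0 : Momentum →L[ℝ] ℝ) with hA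
  set B : Momentum →L[ℝ] Momentum →L[ℝ] ℝ :=
    ((2 * Real.cos (z 1)) • (PiLp.proj 2 (fun _ : Fin 2 => ℝ) 1 : Momentum →L[ℝ] ℝ)).smulRight
      (PiLp.proj 2 (fun _ : Fin 2 => ℝ) 1 : Momentum →L[ℝ] ℝ) with hB
  calc ‖A + B‖ ≤ ‖A‖ + ‖B‖ := norm_add_le A B
    _ ≤ 2 * |Real.cos (z 0)| + 2 * |Real.cos (z 1)| := add_le_add h0 h1
    _ ≤ 4 := by linarith

/-- **`|e|₂ ≤ 4 + |μ|`**: every derivative of order `≤ 2` of `e = ε - μ` has norm `≤ 4 + |μ|`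
(`|e| ≤ 4 + |μ|`, `‖De‖ ≤ 4`, `‖D²e‖ ≤ 4`). [folklore] -/
theorem klfs_norm_iteratedFDeriv_e_le (μ : ℝ) (p : Momentum) (j : ℕ) (hj : j ≤ 2) :
    ‖iteratedFDeriv ℝ j (fun q : Momentum => squareDispersion 1 0 q - μ) p‖ ≤ 4 + |μ| := by
  have hμ := abs_nonneg μ
  interval_cases j
  · rw [norm_iteratedFDeriv_zero, Real.norm_eq_abs]
    have h1 := Real.abs_cos_le_one (p 0); have h2 := Real.abs_cos_le_one (p 1)
    have : |squareDispersion 1 0 p| ≤ 4 := by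
      rw [show squareDispersion 1 0 p = -2 * (Real.cos (p 0) + Real.cos (p 1)) by simp [squareDispersion]]
      rw [abs_le] at h1 h2 ⊢; constructor <;> linarith [h1.1, h1.2, h2.1, h2.2]
    exact (abs_sub _ _).trans (by linarith)
  · rw [norm_iteratedFDeriv_one]; linarith [klfs_norm_fderiv_e_le μ p]
  · rw [← norm_iteratedFDeriv_fderiv, norm_iteratedFDeriv_one]; linarith [klfs_norm_fderiv_fderiv_e_le μ p]

/-! ### §2 `g₀` and `w_min` on the neighbourhood `{|e| < -μ/2}` -/

/-- **`|∇e| ≥ g₀ = √((-μ/2)(4 + 3μ/2))` on `{|e| < -μ/2}`** (`-8/3 < μ < 0`): a point with `|ε(p) - μ| < -μ/2`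
lies on the level `μ' = ε(p) ∈ (3μ/2, μ/2) ⊂ (-4, 0)`, where `‖∇ε‖² ≥ -μ'(4 + μ') ≥ (-μ/2)(4 + 3μ/2)`.
[folklore] -/
theorem klfs_norm_gradient_ge_near {μ : ℝ} (hμ₁ : -8 / 3 < μ) (hμ₂ : μ < 0) {p : Momentum}
    (h : |squareDispersion 1 0 p - μ| < -μ / 2) :
    Real.sqrt (-μ / 2 * (4 + 3 * μ / 2)) ≤ ‖gradient (fun q : Momentum => squareDispersion 1 0 q - μ) p‖ := by
  rw [klfs_gradient_level, norm_gradient_squareDispersion, klfs_two_mul_sqrt]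
  apply Real.sqrt_le_sqrt
  obtain ⟨hl, hr⟩ := abs_lt.1 h
  have he : -2 * (Real.cos (p 0) + Real.cos (p 1)) = squareDispersion 1 0 p := by simp [squareDispersion]
  have hI := (klfs_fermiSpeedSq_mem_Icc he).1
  nlinarith [mul_le_mul (show -μ / 2 ≤ -squareDispersion 1 0 p by linarith)
    (show 4 + 3 * μ / 2 ≤ 4 + squareDispersion 1 0 p by linarith) (by linarith) (by linarith)]

/-- **`(t, e''(p) t) ≥ (-μ/4) |t|²` for `t ⊥ ∇e(p)` on `{|e| < -μ/2}`** (`μ < 0`): at the level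
`μ' = ε(p) < μ/2` the tangent Hessian bound `(-μ'/2)|t|²` of `klfs_hessQuad_tangent_ge` applies. [folklore] -/
theorem klfs_hessQuad_ge_near {μ : ℝ} (hμ₁ : -8 / 3 < μ) (hμ₂ : μ < 0) {p : Momentum}
    (h : |squareDispersion 1 0 p - μ| < -μ / 2) {t : Momentum}
    (ht : inner ℝ (gradient (fun q : Momentum => squareDispersion 1 0 q - μ) p) t = 0) :
    -μ / 4 * ‖t‖ ^ 2 ≤ FermiRG.hessQuad (fun q : Momentum => squareDispersion 1 0 q - μ) p t := by
  obtain ⟨hl, hr⟩ := abs_lt.1 h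
  set μ' := squareDispersion 1 0 p with hμ'
  have hμ'₁ : -4 < μ' := by linarith
  have hμ'₂ : μ' < 0 := by linarith
  have hp' : p ∈ FermiRG.fermiSurface (fun q : Momentum => squareDispersion 1 0 q - μ') := by
    rw [klfs_mem_fermiSurface_iff]
  have ht' : inner ℝ (gradient (fun q : Momentum => squareDispersion 1 0 q - μ') p) t = 0 := by
    rw [klfs_gradient_level] at ht ⊢; exact ht
  have hmain := klfs_hessQuad_tangent_ge hμ'₁ hμ'₂ hp' ht'
  rw [klfs_hessQuad_e] at hmain ⊢
  rw [EuclideanSpace.real_norm_sq_eq, Fin.sum_univ_two]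
  have hv2 : 0 ≤ t 0 ^ 2 + t 1 ^ 2 := by positivity
  nlinarith [mul_le_mul_of_nonneg_right (show -μ / 4 ≤ -μ' / 2 by linarith) hv2]

/-! ### §3 The constants, assembled -/

/-- **FST II's geometric constants for the Hubbard band at level `-8/3 < μ < 0`, closed form**:
`GeomConstants e (4 + |μ|) (-μ/2) (√((-μ/2)(4 + 3μ/2))) (-μ/4)`. [folklore] -/
theorem klfs_geomConstants {μ : ℝ} (hμ₁ : -8 / 3 < μ) (hμ₂ : μ < 0) :
    FermiRG.GeomConstants (fun q : Momentum => squareDispersion 1 0 q - μ)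
      (4 + |μ|) (-μ / 2) (Real.sqrt (-μ / 2 * (4 + 3 * μ / 2))) (-μ / 4) where
  r₀_pos := by linarith
  g₀_pos := Real.sqrt_pos.2 (mul_pos (by linarith) (by linarith))
  wmin_pos := by linarith
  norm_iteratedFDeriv_le := fun p j hj => klfs_norm_iteratedFDeriv_e_le μ p j hj
  le_norm_gradient := fun _ hp => klfs_norm_gradient_ge_near hμ₁ hμ₂ hp
  le_hessQuad := fun _ hp _ ht => klfs_hessQuad_ge_near hμ₁ hμ₂ hp ht

/-- **Uniform constants on the certified window** `μ ∈ [-0.4267, -0.1798]` (image of `δ ∈ [0.10, 0.20]`):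
`|e|₂ ≤ 4.4267`, and on `{|e| < 0.0899}`: `|∇e| ≥ 0.579`, `(t, e'' t) ≥ 0.0449 |t|²` — i.e.
`GeomConstants e 4.4267 0.0899 0.579 0.0449` for every `μ` in the window. [folklore] -/
theorem klfs_window_geomConstants {μ : ℝ} (hμ : μ ∈ Icc (-0.4267 : ℝ) (-0.1798)) :
    FermiRG.GeomConstants (fun q : Momentum => squareDispersion 1 0 q - μ) 4.4267 0.0899 0.579 0.0449 where
  r₀_pos := by norm_num
  g₀_pos := by norm_num
  wmin_pos := by norm_num
  norm_iteratedFDeriv_le := fun p j hj => (klfs_norm_iteratedFDeriv_e_le μ p j hj).trans (by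
    rw [abs_of_neg (by linarith [hμ.2])]; linarith [hμ.1])
  le_norm_gradient := fun p hp => by
    have hμ₁ : -8 / 3 < μ := by linarith [hμ.1]
    have hμ₂ : μ < 0 := by linarith [hμ.2]
    have hp' : |squareDispersion 1 0 p - μ| < -μ / 2 := hp.trans_le (by linarith [hμ.2])
    refine le_trans ?_ (klfs_norm_gradient_ge_near hμ₁ hμ₂ hp')
    apply Real.le_sqrt_of_sq_le
    nlinarith [hμ.1, hμ.2]
  le_hessQuad := fun p hp t ht => by
    have hμ₁ : -8 / 3 < μ := by linarith [hμ.1]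
    have hμ₂ : μ < 0 := by linarith [hμ.2]
    have hp' : |squareDispersion 1 0 p - μ| < -μ / 2 := hp.trans_le (by linarith [hμ.2])
    refine le_trans ?_ (klfs_hessQuad_ge_near hμ₁ hμ₂ hp' ht)
    exact mul_le_mul_of_nonneg_right (by linarith [hμ.2]) (sq_nonneg _)

end Summit.HubbardSuperconductivity.HubbardSuperconductivity.Theorems

end
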